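import Mathlib
import HarnessLib
import Summits.PneNP.PneNP.Theorems.AeaCutRectanglesDutyTransport

/-!
# Route AeaCutRectangles — crux `FoolingMeasure` (stmt-PneNP-19727): SYMMETRISATION NORMAL FORM

X1 (in duty form, `AeaCutRectanglesDutyRectangles.foolingMeasure_iff_duty`) asks for measures that are light on
every duty rectangle over EVERY near-balanced cut.  Averaging a solution over all relabellings of `Fin n` gives a
RELABELLING-INVARIANT solution (rectangles map to rectangles, the window is relabelling-invariant, masses average).
Hence:

* `symmetrise μ` — the average of `μ ∘ relabel σ` over `σ : Equiv.Perm (Fin n)`; it is a probability measure on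
  loopless non-3-colourable edge sets whenever `μ` is (`symmetrise_nonneg`, `symmetrise_sum`,
  `symmetrise_support`), it is invariant (`symmetrise_invariant`), and its duty masses are averages of duty
  masses of `μ` over relabelled cuts (`dutySum_symmetrise`);
* `foolingMeasure_iff_symmetricDuty` — **X1 ⟺ X1 for relabelling-invariant measures** (duty form).  With
  `AeaCutRectanglesDutyTransport.dutySum_eq_of_invariant` an invariant measure needs checking at ONE cut of each
  size in the window.  For the KILL PATH (`NoFoolingMeasure`, stmt-PneNP-19729) this is the useful direction:
  to refute X1 it suffices to find, for every invariant measure, ONE heavy duty rectangle over ONE bisection.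

HONEST FRAMING: an averaging argument; FRONTIER material for a rung of Fagin's complement ladder; nothing here
bears on P vs NP.
-/

set_option linter.dupNamespace false -- `Summit.PneNP.PneNP.…`: summit = sub-problem name (D-0017 single-conjunct layout)

namespace Summit.PneNP.PneNP.Theorems.AeaCutRectanglesDutySymmetric

open Finset
open Summit.PneNP.PneNP.Theorems.AeaCutRectanglesDutyRectangles
open Summit.PneNP.PneNP.Theorems.AeaCutRectanglesDutyTransport

variable {n : ℕ}

/-! ### Relabelling twice -/

/-- Relabelling by `τ` then by `σ` is relabelling by `τ.trans σ`. -/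
theorem relabel_relabel {V : Type*} [DecidableEq V] (σ τ : Equiv.Perm V) (G : Finset (Sym2 V)) :
    relabel σ (relabel τ G) = relabel (τ.trans σ) G := by
  simp only [relabel, Finset.image_image]
  congr 1
  funext e
  simp only [Function.comp_apply, Sym2.map_map]
  rfl

/-! ### The symmetrised measure -/

/-- The SYMMETRISATION of `μ`: the average of `μ ∘ relabel σ` over all relabellings `σ` of `Fin n`. -/
noncomputable def symmetrise (μ : Finset (Sym2 (Fin n)) → ℝ) : Finset (Sym2 (Fin n)) → ℝ :=
  fun G => (∑ σ : Equiv.Perm (Fin n), μ (relabel σ G)) / (Fintype.card (Equiv.Perm (Fin n)) : ℝ)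

/-- The number of relabellings is positive (as a real). -/
theorem card_perm_pos : (0 : ℝ) < (Fintype.card (Equiv.Perm (Fin n)) : ℝ) := by
  exact_mod_cast Fintype.card_pos

/-- The symmetrisation of a non-negative function is non-negative. -/
theorem symmetrise_nonneg {μ : Finset (Sym2 (Fin n)) → ℝ} (h0 : ∀ S, 0 ≤ μ S) (G : Finset (Sym2 (Fin n))) :
    0 ≤ symmetrise μ G :=
  div_nonneg (sum_nonneg fun _ _ => h0 _) card_perm_pos.le

/-- Symmetrisation preserves total mass `1`. -/
theorem symmetrise_sum {μ : Finset (Sym2 (Fin n)) → ℝ} (h1 : ∑ S, μ S = 1) :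
    ∑ G, symmetrise μ G = 1 := by
  simp only [symmetrise]
  rw [← sum_div, sum_comm]
  have h : ∀ σ : Equiv.Perm (Fin n), ∑ G : Finset (Sym2 (Fin n)), μ (relabel σ G) = 1 := fun σ => by
    rw [← h1]
    exact Finset.sum_bijective (relabel σ)
      ⟨relabel_injective σ, fun G => ⟨relabel σ.symm G, relabel_relabel_symm σ G⟩⟩
      (fun _ => by simp) (fun _ _ => rfl)
  simp only [h, sum_const, card_univ, nsmul_eq_mul, mul_one]
  exact div_self card_perm_pos.ne'

/-- Symmetrisation preserves "supported on loopless non-3-colourable edge sets". -/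
theorem symmetrise_support {μ : Finset (Sym2 (Fin n)) → ℝ}
    (hs : ∀ S, μ S ≠ 0 → (∀ e ∈ S, ¬ e.IsDiag) ∧
      ¬ (SimpleGraph.fromEdgeSet (S : Set (Sym2 (Fin n)))).Colorable 3)
    (G : Finset (Sym2 (Fin n))) (hG : symmetrise μ G ≠ 0) :
    (∀ e ∈ G, ¬ e.IsDiag) ∧ ¬ (SimpleGraph.fromEdgeSet (G : Set (Sym2 (Fin n)))).Colorable 3 := by
  have hsum : ∑ σ : Equiv.Perm (Fin n), μ (relabel σ G) ≠ 0 := by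
    intro h
    apply hG
    simp [symmetrise, h]
  obtain ⟨σ, -, hσ⟩ := Finset.exists_ne_zero_of_sum_ne_zero hsum
  obtain ⟨hl, hc⟩ := hs _ hσ
  refine ⟨fun e he => ?_, ?_⟩
  · have h := relabel_loopless (σ := σ.symm) hl
    rw [relabel_symm_relabel] at h
    exact h e he
  · rwa [colorable_relabel_iff] at hc

/-- The symmetrisation is relabelling-invariant. -/
theorem symmetrise_invariant (μ : Finset (Sym2 (Fin n)) → ℝ) (τ : Equiv.Perm (Fin n))
    (G : Finset (Sym2 (Fin n))) : symmetrise μ (relabel τ G) = symmetrise μ G := by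
  simp only [symmetrise, relabel_relabel]
  congr 1
  exact Fintype.sum_equiv (Equiv.mulRight τ) _ _ fun σ => by
    simp only [Equiv.coe_mulRight, Equiv.Perm.mul_def]

/-- **Duty masses of the symmetrisation are averages** of duty masses of `μ` over the relabelled cuts/duties. -/
theorem dutySum_symmetrise (μ : Finset (Sym2 (Fin n)) → ℝ) (B : Finset (Fin n)) (Φ : Set (Fin n → Fin 3)) :
    ∑ G ∈ dutyFinset B Φ, symmetrise μ G =
      (∑ σ : Equiv.Perm (Fin n), ∑ G' ∈ dutyFinset (B.image σ) (dutyMap σ Φ), μ G') /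
        (Fintype.card (Equiv.Perm (Fin n)) : ℝ) := by
  simp only [symmetrise]
  rw [← sum_div, sum_comm]
  congr 1
  exact sum_congr rfl fun σ _ => (dutySum_relabel σ μ B Φ).symm

/-- A duty bound for `μ` at every cut of the same cardinality as `B` gives the same bound for `symmetrise μ` at `B`. -/
theorem dutySum_symmetrise_le {μ : Finset (Sym2 (Fin n)) → ℝ} {B : Finset (Fin n)} {δ : ℝ}
    (h : ∀ B' : Finset (Fin n), B'.card = B.card → ∀ Ψ : Set (Fin n → Fin 3), ∑ G ∈ dutyFinset B' Ψ, μ G ≤ δ)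
    (Φ : Set (Fin n → Fin 3)) : ∑ G ∈ dutyFinset B Φ, symmetrise μ G ≤ δ := by
  rw [dutySum_symmetrise, div_le_iff₀ card_perm_pos]
  calc ∑ σ : Equiv.Perm (Fin n), ∑ G' ∈ dutyFinset (B.image σ) (dutyMap σ Φ), μ G'
      ≤ ∑ _σ : Equiv.Perm (Fin n), δ :=
        sum_le_sum fun σ _ => h _ (card_image_of_injective _ σ.injective) _
    _ = δ * (Fintype.card (Equiv.Perm (Fin n)) : ℝ) := by
        rw [sum_const, card_univ, nsmul_eq_mul, mul_comm]

/-! ### X1 ⟺ X1 for relabelling-invariant measures -/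

/-- **SYMMETRISATION NORMAL FORM.**  The crux X1 holds iff its duty form holds with a RELABELLING-INVARIANT
measure (same `ε`, same `C ↦ n` schedule; the measure is the symmetrisation of any solution).  Consequently
(with `dutySum_eq_of_invariant`) X1 is a statement about one cut of each size in the window, and its kill path
needs a heavy duty rectangle only against invariant measures. -/
theorem foolingMeasure_iff_symmetricDuty :
    Summit.PneNP.PneNP.Theses.AeaCutRectangles.FoolingMeasure ↔
    ∃ ε : ℝ, 0 < ε ∧ ε ≤ 1 / 4 ∧ ∀ C : ℕ, ∃ᶠ n in Filter.atTop, ∃ μ : Finset (Sym2 (Fin n)) → ℝ,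
      (∀ S, 0 ≤ μ S) ∧ (∑ S, μ S = 1) ∧
      (∀ S, μ S ≠ 0 → (∀ e ∈ S, ¬ e.IsDiag) ∧
        ¬ (SimpleGraph.fromEdgeSet (S : Set (Sym2 (Fin n)))).Colorable 3) ∧
      (∀ σ : Equiv.Perm (Fin n), ∀ S, μ (relabel σ S) = μ S) ∧
      ∀ B : Finset (Fin n), (1 / 2 - ε) * (n : ℝ) ≤ B.card → (B.card : ℝ) ≤ (1 / 2 + ε) * n →
        ∀ Φ : Set (Fin n → Fin 3),
          ∑ G ∈ dutyFinset B Φ, μ G ≤ (2 : ℝ) ^ (-((n : ℝ) / 2 * Real.logb 2 n) - (C : ℝ) * n) := by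
  rw [foolingMeasure_iff_duty]
  constructor
  · rintro ⟨ε, hε0, hε1, hC⟩
    refine ⟨ε, hε0, hε1, fun C => (hC C).mono fun n hn => ?_⟩
    obtain ⟨μ, h0, h1, hs, hr⟩ := hn
    refine ⟨symmetrise μ, symmetrise_nonneg h0, symmetrise_sum h1, symmetrise_support hs,
      symmetrise_invariant μ, fun B hB1 hB2 Φ => ?_⟩
    refine dutySum_symmetrise_le (fun B' hB' Ψ => ?_) Φ
    exact hr B' (by rw [hB']; exact hB1) (by rw [hB']; exact hB2) Ψ
  · rintro ⟨ε, hε0, hε1, hC⟩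
    refine ⟨ε, hε0, hε1, fun C => (hC C).mono fun n hn => ?_⟩
    obtain ⟨μ, h0, h1, hs, -, hr⟩ := hn
    exact ⟨μ, h0, h1, hs, hr⟩

end Summit.PneNP.PneNP.Theorems.AeaCutRectanglesDutySymmetric
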